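import Summits.NavierStokesRegularity.NavierStokesRegularity.Theorems.ExtremiserTransienceTwoThirdsGoodBallsLimit
import HarnessLib

/-!
# Route `ExtremiserTransience`, crux `NearExtremalTransiencePerFlow` (stmt-NavierStokesRegularity-26567),
# LINE g10-1 `two_thirds` (ns-idea-10): S1b′ step 2 — THE LIMIT EXTRACTION LEMMA at LARGE SCALES

`--supports stmt-NavierStokesRegularity-26567 --as helper` (prover seat ns-net-p2 g12).  The large-scale re-typing S1a′/S1b′ (REV 1.3 of
`Lines/two_thirds.lean`, idea-crit-4 ruling 14:07:21Z) supplies good balls of the normalised slices only at scales `i ≥ i₁`.  This file is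
p720164's `exists_doubling_goodBalls_of_limit` with exactly that weakening: `exists_doubling_goodBalls_of_limit_large` — if smooth `Fn → V`
pointwise with uniform derivative budgets, each `Fn` thick at the origin and carrying for every scale `i₁ ≤ i ≤ n` a good ball `B(c,ρ)`
(`‖c‖ ≤ ρ/2`, `ρ ∈ [4^i, 2·4^i]`, tolerance `K/(i+1)`), then `V` has, for infinitely many `i`, a `4^{10}`-doubling good ball at scale `i` of
enstrophy `≥ b₀ = Z_{B(0,1/2)}(V) > 0` (the 4-adic counting is run past `max i₀ i₁`).  Proof verbatim otherwise (credit: the p720164 text,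
ns-net-p2 g11).  HONEST FRAMING: analysis only; S1a′/S2, ⟨26567⟩ and NS regularity are OPEN; no summit is proved by a line. [folklore]
-/

noncomputable section

open scoped Topology InnerProductSpace RealInnerProductSpace ENNReal ContDiff
open MeasureTheory Filter Set Metric
open Literature.Analysis.FluidPDE
open Summit.NavierStokesRegularity.NavierStokesRegularity.Theorems.DepletionLadder.KStar.HalfSpace
open Summit.NavierStokesRegularity.NavierStokesRegularity.Theorems.DepletionLadder.KStar.BangBang
open Summit.NavierStokesRegularity.NavierStokesRegularity.Theorems.NearExtremalTransiencePerFlow.ZoneTransversality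
open Summit.NavierStokesRegularity.NavierStokesRegularity.Theorems.NearExtremalTransiencePerFlow.LocalMaximiser

namespace Summit.NavierStokesRegularity.NavierStokesRegularity.Theorems.NearExtremalTransiencePerFlow.TwoThirds

-- the problem directory repeats the summit name (`NavierStokesRegularity/NavierStokesRegularity`)
set_option linter.dupNamespace false

/-- **Limit extraction lemma, LARGE-SCALE form** (the S1b′ bookkeeping in the limit; verbatim `exists_doubling_goodBalls_of_limit` of
p720164 except that the good balls of `Fn n` are assumed only at the scales `i₁ ≤ i ≤ n`, and the doubling scale is sought past `max i₀ i₁`).  Smooth fields `Fn → V` pointwise with uniform derivative budgets,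
thick at the origin (`‖curl Fn 0‖ ≥ θ₀ > 0`) and carrying, for every `n` and every scale `i ≤ n`, a good ball `B(c, ρ)` with
`‖c‖ ≤ ρ/2`, `ρ ∈ [4^i, 2·4^i]`, tolerance `K/(i+1)`: then the limit `V` has, for infinitely many `i`, a `4^{10}`-doubling good ball at
scale `i` of enstrophy `≥ b₀ = Z_{B(0,1/2)}(V) > 0`. -/
theorem exists_doubling_goodBalls_of_limit_large {Fn : ℕ → E3 → E3} {V : E3 → E3} {θ₀ K : ℝ} {i₁ : ℕ}
    (hFn : ∀ n, ContDiff ℝ (⊤ : ℕ∞) (Fn n)) (hV : ContDiff ℝ (⊤ : ℕ∞) V)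
    (hb : ∀ k : ℕ, ∃ C : ℝ, (∀ n x, ‖iteratedFDeriv ℝ k (Fn n) x‖ ≤ C) ∧ ∀ x, ‖iteratedFDeriv ℝ k V x‖ ≤ C)
    (hpt : ∀ x, Tendsto (fun n => Fn n x) atTop (𝓝 (V x)))
    (hθ₀ : 0 < θ₀) (hthick : ∀ n, θ₀ ≤ ‖curl (Fn n) 0‖)
    (hballs : ∀ n i : ℕ, i₁ ≤ i → i ≤ n → ∃ (c : E3) (ρ : ℝ), ‖c‖ ≤ ρ / 2 ∧ (4 : ℝ) ^ i ≤ ρ ∧ ρ ≤ 2 * (4 : ℝ) ^ i ∧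
      IsGoodBall (Fn n) c ρ (K / (i + 1))) :
    ∃ b₀ : ℝ, 0 < b₀ ∧ ∀ i₀ : ℕ, ∃ (i : ℕ) (c : E3) (r : ℝ), i₀ ≤ i ∧ (4 : ℝ) ^ i ≤ r ∧ r ≤ 2 * (4 : ℝ) ^ i ∧
      b₀ ≤ Zb V c r ∧ IsDoubling V c r (4 ^ 10) ∧ IsGoodBall V c r (K / (i + 1)) := by
  -- ### A. a good ball of the limit at EVERY scale (subsequence per scale; the tolerance is fixed per scale)
  have hlimball : ∀ i : ℕ, i₁ ≤ i → ∃ (c : E3) (r : ℝ), ‖c‖ ≤ r / 2 ∧ (4 : ℝ) ^ i ≤ r ∧ r ≤ 2 * (4 : ℝ) ^ i ∧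
      IsGoodBall V c r (K / (i + 1)) := by
    intro i hi₁
    have h4i : (0 : ℝ) < 4 ^ i := by positivity
    choose c ρ hc h4 h24 hgood using fun n : ℕ => hballs (n + i) i hi₁ (Nat.le_add_left i n)
    have hmem : ∀ n, (c n, ρ n) ∈ Metric.closedBall (0 : E3) (4 ^ i) ×ˢ Set.Icc ((4 : ℝ) ^ i) (2 * 4 ^ i) := fun n =>
      ⟨by rw [Metric.mem_closedBall, dist_zero_right]; linarith [hc n, h24 n], h4 n, h24 n⟩
    obtain ⟨a, ha, φ, hφ, hconv⟩ := tendsto_subseq_of_bounded (Metric.isBounded_closedBall.prod (Metric.isBounded_Icc _ _)) hmem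
    rw [(Metric.isClosed_closedBall.prod isClosed_Icc).closure_eq] at ha
    have hcT : Tendsto (fun n => c (φ n)) atTop (𝓝 a.1) := (continuous_fst.tendsto a).comp hconv
    have hρT : Tendsto (fun n => ρ (φ n)) atTop (𝓝 a.2) := (continuous_snd.tendsto a).comp hconv
    have hshift : Tendsto (fun n => φ n + i) atTop atTop :=
      tendsto_atTop_mono (fun n => (hφ.id_le n).trans (Nat.le_add_right _ _)) tendsto_id
    have hgood' : IsGoodBall V a.1 a.2 (K / (i + 1)) :=
      isGoodBall_of_limit (Fn := fun n => Fn (φ n + i)) (fun n => hFn _) hV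
        (fun k => by obtain ⟨C, h1, h2⟩ := hb k; exact ⟨C, fun n x => h1 _ x, h2⟩)
        (fun x => (hpt x).comp hshift) hcT hρT (Rc := 4 ^ i) (Rρ := 2 * 4 ^ i)
        (fun n => by linarith [hc (φ n), h24 (φ n)]) (fun n => h24 (φ n)) (fun n => by linarith [h4 (φ n)])
        fun n => hgood (φ n)
    refine ⟨a.1, a.2, ?_, ha.2.1, ha.2.2, hgood'⟩
    exact le_of_tendsto_of_tendsto' hcT.norm (hρT.div_const 2) fun n => hc (φ n)
  -- ### B. positivity at the origin from thickness
  obtain ⟨C1, -, hC1⟩ := hb 1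
  obtain ⟨C2, -, hC2⟩ := hb 2
  have hcurl0 : θ₀ ≤ ‖curl V 0‖ := ge_of_tendsto' (tendsto_curl_of_bounds hFn hV hb hpt 0).norm hthick
  have hLip : ∀ x, ‖fderiv ℝ (curl V) x‖ ≤ 4 * C2 := fun x => by
    rw [← norm_iteratedFDeriv_one]
    exact (norm_iteratedFDeriv_curl_le_four_mul hV 1 x).trans (by linarith [hC2 x])
  have hC2nn : 0 ≤ C2 := (norm_nonneg _).trans (hC2 0)
  have hb₀ : 0 < Zb V 0 (1 / 2) := Zb_half_pos hV hθ₀ (by positivity) hcurl0 hLip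
  -- ### C. the bulk at the 4-adic scales: `b₀ ≤ β j ≤ Kb·64^j`
  set β : ℕ → ℝ := fun j => Zb V 0 (4 ^ j) + Wb V 0 (4 ^ j) with hβ
  have hbd := fun x => sd_zd_wd_bounds hV hC1 hC2 x
  obtain ⟨vol1, hvol1def⟩ : ∃ vol1 : ℝ, vol1 = (volume : Measure E3).real (Metric.ball (0 : E3) 1) := ⟨_, rfl⟩
  have hvol1 : 0 ≤ vol1 := by rw [hvol1def]; exact measureReal_nonneg
  have hlow : ∀ j, Zb V 0 (1 / 2) ≤ β j := fun j => by
    have h1 : Zb V 0 (1 / 2) ≤ Zb V 0 (4 ^ j) :=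
      Zb_mono hV (Metric.ball_subset_ball ((by norm_num : (1 : ℝ) / 2 ≤ 1).trans (one_le_pow₀ (by norm_num))))
    have h2 := Wb_nonneg V 0 (4 ^ j)
    simp only [hβ]; linarith
  have hup : ∀ j, β j ≤ (16 * C1 ^ 2 + 48 * C2 ^ 2) * vol1 * 64 ^ j := fun j => by
    have e : (volume : Measure E3).real (Metric.ball (0 : E3) (4 ^ j)) = 64 ^ j * vol1 := by
      rw [volume_real_ball_eq 0 (by positivity), ← hvol1def, ← pow_mul, mul_comm j 3, pow_mul]; norm_num
    have hZ : Zb V 0 (4 ^ j) ≤ 16 * C1 ^ 2 * (64 ^ j * vol1) := by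
      rw [← e]; exact setIntegral_ball_le_of_le (fun x => (hbd x).2.1) (continuous_zd' hV) 0 _
    have hW : Wb V 0 (4 ^ j) ≤ 48 * C2 ^ 2 * (64 ^ j * vol1) := by
      rw [← e]; exact setIntegral_ball_le_of_le (fun x => (hbd x).2.2) (continuous_wd' hV) 0 _
    simp only [hβ]; linarith
  -- ### D. conclusion
  refine ⟨Zb V 0 (1 / 2), hb₀, fun i₀ => ?_⟩
  obtain ⟨i, hi₀', hi1, hratio⟩ := exists_three_step_ratio_le hb₀ hlow hup (max i₀ i₁)
  have hi₀ : i₀ ≤ i := (le_max_left _ _).trans hi₀'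
  obtain ⟨c, r, hc, h4, h24, hgood⟩ := hlimball i ((le_max_right _ _).trans hi₀')
  have h4i : (1 : ℝ) ≤ 4 ^ i := one_le_pow₀ (by norm_num)
  have hr1 : 1 ≤ r := h4i.trans h4
  refine ⟨i, c, r, hi₀, h4, h24, Zb_mono hV (ball_half_subset hc hr1), ?_, hgood⟩
  -- doubling: `bulk(c,4r) ≤ β(i+2) ≤ 4^{10} β(i−1) ≤ 4^{10} bulk(c,r)`
  have hout : Metric.ball c (4 * r) ⊆ Metric.ball (0 : E3) (4 ^ (i + 2)) := by
    intro x hx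
    rw [Metric.mem_ball, dist_eq_norm] at hx
    rw [Metric.mem_ball, dist_zero_right, pow_add]
    calc ‖x‖ ≤ ‖x - c‖ + ‖c‖ := by
          calc ‖x‖ = ‖(x - c) + c‖ := by rw [sub_add_cancel]
            _ ≤ ‖x - c‖ + ‖c‖ := norm_add_le _ _
      _ < 4 * r + r / 2 := by linarith
      _ ≤ 4 ^ i * 4 ^ 2 := by nlinarith [h24]
  have hin : Metric.ball (0 : E3) (4 ^ (i - 1)) ⊆ Metric.ball c r := by
    intro x hx
    rw [Metric.mem_ball, dist_zero_right] at hx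
    rw [Metric.mem_ball, dist_eq_norm]
    have e : (4 : ℝ) ^ i = 4 * 4 ^ (i - 1) := by
      rw [← pow_succ']; congr 1; omega
    calc ‖x - c‖ ≤ ‖x‖ + ‖c‖ := norm_sub_le _ _
      _ < 4 ^ (i - 1) + r / 2 := by linarith
      _ ≤ r := by nlinarith [h4, e]
  unfold IsDoubling
  have h1 : Zb V c (4 * r) + Wb V c (4 * r) ≤ β (i + 2) := add_le_add (Zb_mono hV hout) (Wb_mono hV hout)
  have h2 : β (i - 1) ≤ Zb V c r + Wb V c r := add_le_add (Zb_mono hV hin) (Wb_mono hV hin)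
  calc Zb V c (4 * r) + Wb V c (4 * r) ≤ β (i + 2) := h1
    _ ≤ 4 ^ 10 * β (i - 1) := hratio
    _ ≤ 4 ^ 10 * (Zb V c r + Wb V c r) := mul_le_mul_of_nonneg_left h2 (by positivity)

end Summit.NavierStokesRegularity.NavierStokesRegularity.Theorems.NearExtremalTransiencePerFlow.TwoThirds

end
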